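import Literature.Combinatorics.LorentzianPolynomials.PartitionCauchySchwarz
import Literature.LinearAlgebra.QuadraticForm.LorentzianReverseSchwarz
import Mathlib.LinearAlgebra.Matrix.BilinearForm
import HarnessLib

/-!
# The signature of the Hessian of `∂^α f_M`: a weighted loop vertex joined to a complete multipartite graph has at most
# one positive eigenvalue (Brändén–Huh 2020, §4.3, proof of Thm. 4.10 with Lemma 4.12)

Layer `Literature/Combinatorics/LorentzianPolynomials`, namespace `Literature.Combinatorics.LorentzianPolynomials`;
lane `lit-hodgefound` (Track 2 foundations library), seat p16, generation 27 (row g27-#24). The linear-algebra core of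
"`f_M` is Lorentzian" (the `q → 0` end of Brändén–Huh Thm. 4.10, see `IndependencePolynomial.lean`,
`indepGenPoly_mem_lorentzian_iff`), abstracted from the matroid: on the index set `Option τ` (`none` = the homogenising
variable `w_0`), for a finite set `E ⊆ τ` of "non-loops" partitioned into classes by a map `p : τ → κ` ("parallel classes")
and a real `m ≥ #E`, `m > 1`, the symmetric matrix
`H = [[m(m-1), (m-1)·𝟙_E^T], [(m-1)·𝟙_E, ([k, l ∈ E, p k ≠ p l])_{k,l}]]`
has at most one positive eigenvalue. Proof as printed for `Z_{q,M}`: restrict to the `H`-orthogonal complement of `e_0`,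
where `z^T H z = s²/m - Σ_c s_c² ≤ 0` (`s = Σ_{k∈E} z_k`, `s_c` the class sums) by Lemma 4.12
(`sq_sum_le_card_mul_sum_fiber_sq_of_subset`) — "The conclusion now follows from Lemma 4.12."

## Source (verbatim) — P. Brändén, J. Huh, *Lorentzian polynomials* [BrandenHuh2019] (held `paper:arxiv-1902.03719`)

§4.3, proof of Thm. 4.10: "Thus, it is enough to prove that the following quadratic form is stable:
`(n!/2) w_0^2 + (n-1)! Z^1_{q,M}(w) w_0 + (n-2)! Z^2_{q,M}(w)`. […] it suffices to show that the discriminant of the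
displayed quadratic form with respect to `w_0` is nonnegative: `Z^1_{q,M}(w)^2 ≥ 2 (n/(n-1)) Z^2_{q,M}(w)` for all
`w ∈ ℝ^n`. […] `Z^1_{q,M}(w) = e^1_{[n]}(w)` and `Z^2_{q,M}(w) = e^2_{[n]}(w) - (1-q)(e^2_{P_1}(w) + ⋯ + e^2_{P_ℓ}(w))`. […]
Note that the left-hand side of the above inequality simplifies to
`n (e^1_{P_1}(w)^2 + ⋯ + e^1_{P_ℓ}(w)^2 + Σ_{i ∈ L} w_i^2) - e^1_{[n]}(w)^2`. The conclusion now follows from Lemma 4.12."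

## What is here

* `loopMultipartiteMatrix E p m` (the matrix `H` above on `Option τ`), its entries and symmetry;
* `toBilin'_loopMultipartite_single_none` (`z^T H e_0 = m(m-1) z_0 + (m-1) s`), `toBilin'_loopMultipartite_self`
  (`z^T H z = m(m-1) z_0² + 2(m-1) z_0 s + Σ_{k,l∈E, p k ≠ p l} z_k z_l`), `sum_sum_ite_ne_eq` (the last sum is
  `s² - Σ_c s_c²`);
* **`sigPos_loopMultipartite_le_one`** (`#E ≤ m`, `1 < m` ⟹ at most one positive eigenvalue), via
  `sigPos_le_one_of_orthogonal_nonpos` at `e_0` and Lemma 4.12.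

One definition with body (`loopMultipartiteMatrix`), theorems otherwise; no `sorry`, no named fact.

## References

* [BrandenHuh2019] P. Brändén, J. Huh, *Lorentzian polynomials*, Ann. of Math. (2) 192 (2020) 821–891, arXiv:1902.03719 —
  §4.3 proof of Thm. 4.10, Lemma 4.12.
-/

noncomputable section

open Finset Matrix
open Literature.LinearAlgebra.QuadraticForm

namespace Literature.Combinatorics.LorentzianPolynomials

variable {τ κ : Type*} [Fintype τ] [DecidableEq τ] [DecidableEq κ]

/-! ## §1 The matrix -/

section Matrix

/-- **The weighted "loop + complete multipartite" matrix** on `Option τ`: `H_{00} = m(m-1)`, `H_{0k} = H_{k0} = (m-1)[k ∈ E]`,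
`H_{kl} = [k, l ∈ E, p k ≠ p l]` (so `H_{kk} = 0`): up to the factor `(m-2)!`, the Hessian of `∂^α f_M` for
`α = (m-2) e_0 + e_S` (`E` = non-loops of `M/S`, `p` = parallel class). [cite: BrandenHuh2019, §4.3 proof of Thm. 4.10
("`(n!/2) w_0^2 + (n-1)! Z^1 w_0 + (n-2)! Z^2`")] -/
def loopMultipartiteMatrix (E : Finset τ) (p : τ → κ) (m : ℝ) : Matrix (Option τ) (Option τ) ℝ :=
  Matrix.of fun i j ↦ Option.elim i
    (Option.elim j (m * (m - 1)) fun l ↦ if l ∈ E then m - 1 else 0)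
    fun k ↦ Option.elim j (if k ∈ E then m - 1 else 0) fun l ↦ if k ∈ E ∧ l ∈ E ∧ p k ≠ p l then 1 else 0

omit [Fintype τ] in
/-- `H_{00} = m(m-1)`. [cite: BrandenHuh2019, §4.3 proof of Thm. 4.10] -/
theorem loopMultipartite_none_none (E : Finset τ) (p : τ → κ) (m : ℝ) :
    loopMultipartiteMatrix E p m none none = m * (m - 1) := rfl

omit [Fintype τ] in
/-- `H_{0l} = (m-1)[l ∈ E]`. [cite: BrandenHuh2019, §4.3 proof of Thm. 4.10] -/
theorem loopMultipartite_none_some (E : Finset τ) (p : τ → κ) (m : ℝ) (l : τ) :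
    loopMultipartiteMatrix E p m none (some l) = if l ∈ E then m - 1 else 0 := rfl

omit [Fintype τ] in
/-- `H_{k0} = (m-1)[k ∈ E]`. [cite: BrandenHuh2019, §4.3 proof of Thm. 4.10] -/
theorem loopMultipartite_some_none (E : Finset τ) (p : τ → κ) (m : ℝ) (k : τ) :
    loopMultipartiteMatrix E p m (some k) none = if k ∈ E then m - 1 else 0 := rfl

omit [Fintype τ] in
/-- `H_{kl} = [k, l ∈ E, p k ≠ p l]`. [cite: BrandenHuh2019, §4.3 proof of Thm. 4.10] -/
theorem loopMultipartite_some_some (E : Finset τ) (p : τ → κ) (m : ℝ) (k l : τ) :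
    loopMultipartiteMatrix E p m (some k) (some l) = if k ∈ E ∧ l ∈ E ∧ p k ≠ p l then 1 else 0 := rfl

omit [Fintype τ] in
/-- `H` is symmetric. [cite: BrandenHuh2019, §4.3 proof of Thm. 4.10] -/
theorem loopMultipartite_comm (E : Finset τ) (p : τ → κ) (m : ℝ) (i j : Option τ) :
    loopMultipartiteMatrix E p m i j = loopMultipartiteMatrix E p m j i := by
  cases i with
  | none => cases j with
    | none => rfl
    | some l => rfl
  | some k => cases j with
    | none => rfl
    | some l =>
      rw [loopMultipartite_some_some, loopMultipartite_some_some]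
      by_cases h : k ∈ E ∧ l ∈ E ∧ p k ≠ p l
      · rw [if_pos h, if_pos ⟨h.2.1, h.1, fun e ↦ h.2.2 e.symm⟩]
      · rw [if_neg h, if_neg (fun h' ↦ h ⟨h'.2.1, h'.1, fun e ↦ h'.2.2 e.symm⟩)]

end Matrix

/-! ## §2 The quadratic form on `e_0^⊥` and its signature -/

section Signature

/-- `z^T H e_0 = m(m-1) z_0 + (m-1) Σ_{k∈E} z_k`. [cite: BrandenHuh2019, §4.3 proof of Thm. 4.10] -/
theorem toBilin'_loopMultipartite_single_none (E : Finset τ) (p : τ → κ) (m : ℝ) (z : Option τ → ℝ) :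
    Matrix.toBilin' (loopMultipartiteMatrix E p m) z (Pi.single none 1) =
      m * (m - 1) * z none + (m - 1) * ∑ k ∈ E, z (some k) := by
  rw [Matrix.toBilin'_apply]
  simp_rw [Fintype.sum_option, Pi.single_eq_same, Pi.single_eq_of_ne (Option.some_ne_none _), mul_zero,
    Finset.sum_const_zero, add_zero, mul_one, loopMultipartite_none_none, loopMultipartite_some_none]
  rw [Finset.mul_sum, ← Finset.sum_filter_add_sum_filter_not univ (· ∈ E)]
  have h1 : ∑ k ∈ univ.filter (· ∈ E), z (some k) * (if k ∈ E then m - 1 else 0) = ∑ k ∈ E, (m - 1) * z (some k) := by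
    rw [Finset.filter_mem_eq_inter, Finset.univ_inter]
    exact Finset.sum_congr rfl fun k hk ↦ by rw [if_pos hk, mul_comm]
  have h2 : ∑ k ∈ univ.filter (fun k ↦ ¬ k ∈ E), z (some k) * (if k ∈ E then m - 1 else 0) = 0 :=
    Finset.sum_eq_zero fun k hk ↦ by rw [if_neg (Finset.mem_filter.1 hk).2, mul_zero]
  rw [h1, h2, add_zero]
  ring

/-- `z^T H z = m(m-1) z_0² + 2(m-1) z_0 s + Σ_{k,l ∈ E, p k ≠ p l} z_k z_l` with `s = Σ_{k∈E} z_k`.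
[cite: BrandenHuh2019, §4.3 proof of Thm. 4.10] -/
theorem toBilin'_loopMultipartite_self (E : Finset τ) (p : τ → κ) (m : ℝ) (z : Option τ → ℝ) :
    Matrix.toBilin' (loopMultipartiteMatrix E p m) z z =
      m * (m - 1) * z none ^ 2 + 2 * (m - 1) * z none * (∑ k ∈ E, z (some k)) +
        ∑ k ∈ E, ∑ l ∈ E, if p k ≠ p l then z (some k) * z (some l) else 0 := by
  rw [Matrix.toBilin'_apply, Fintype.sum_option]
  simp_rw [Fintype.sum_option, loopMultipartite_none_none, loopMultipartite_none_some, loopMultipartite_some_none,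
    loopMultipartite_some_some]
  -- the four blocks
  have hA : ∑ l : τ, z none * (if l ∈ E then m - 1 else 0) * z (some l) = (m - 1) * z none * ∑ k ∈ E, z (some k) := by
    rw [Finset.mul_sum, ← Finset.sum_subset (Finset.subset_univ E) (fun l _ hl ↦ by rw [if_neg hl, mul_zero, zero_mul])]
    exact Finset.sum_congr rfl fun l hl ↦ by rw [if_pos hl]; ring
  have hB : ∑ k : τ, z (some k) * (if k ∈ E then m - 1 else 0) * z none = (m - 1) * z none * ∑ k ∈ E, z (some k) := by
    rw [Finset.mul_sum, ← Finset.sum_subset (Finset.subset_univ E) (fun k _ hk ↦ by rw [if_neg hk, mul_zero, zero_mul])]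
    exact Finset.sum_congr rfl fun k hk ↦ by rw [if_pos hk]; ring
  have hC : ∑ k : τ, ∑ l : τ, z (some k) * (if k ∈ E ∧ l ∈ E ∧ p k ≠ p l then 1 else 0) * z (some l) =
      ∑ k ∈ E, ∑ l ∈ E, if p k ≠ p l then z (some k) * z (some l) else 0 := by
    rw [← Finset.sum_subset (Finset.subset_univ E) (fun k _ hk ↦ Finset.sum_eq_zero fun l _ ↦ by
      rw [if_neg (fun h ↦ hk h.1), mul_zero, zero_mul])]
    refine Finset.sum_congr rfl fun k hk ↦ ?_
    rw [← Finset.sum_subset (Finset.subset_univ E) (fun l _ hl ↦ by rw [if_neg (fun h ↦ hl h.2.1), mul_zero, zero_mul])]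
    refine Finset.sum_congr rfl fun l hl ↦ ?_
    by_cases h : p k ≠ p l
    · rw [if_pos ⟨hk, hl, h⟩, if_pos h, mul_one]
    · rw [if_neg (fun h' ↦ h h'.2.2), if_neg h, mul_zero, zero_mul]
  simp_rw [Finset.sum_add_distrib]
  rw [hA, hB, hC]
  ring

omit [Fintype τ] [DecidableEq τ] in
/-- `Σ_{k,l∈E, p k ≠ p l} z_k z_l = s² - Σ_c s_c²` (`s_c = Σ_{k ∈ E, p k = c} z_k`): the "independent pairs" are all pairs
minus the pairs inside a class ("`e^2_{[n]} - (e^2_{P_1} + ⋯ + e^2_{P_ℓ})`", doubled and with the diagonal).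
[cite: BrandenHuh2019, §4.3 proof of Thm. 4.10] -/
theorem sum_sum_ite_ne_eq (E : Finset τ) (p : τ → κ) (x : τ → ℝ) :
    ∑ k ∈ E, ∑ l ∈ E, (if p k ≠ p l then x k * x l else 0) =
      (∑ k ∈ E, x k) ^ 2 - ∑ c ∈ E.image p, (∑ k ∈ E.filter (fun k ↦ p k = c), x k) ^ 2 := by
  have hsq : (∑ k ∈ E, x k) ^ 2 = ∑ k ∈ E, ∑ l ∈ E, x k * x l := by rw [sq, Finset.sum_mul_sum]
  have hcl : ∑ c ∈ E.image p, (∑ k ∈ E.filter (fun k ↦ p k = c), x k) ^ 2 =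
      ∑ k ∈ E, ∑ l ∈ E, if p k = p l then x k * x l else 0 := by
    rw [← Finset.sum_fiberwise_of_maps_to (g := p) (fun k hk ↦ Finset.mem_image_of_mem p hk)
      (f := fun k ↦ ∑ l ∈ E, if p k = p l then x k * x l else 0)]
    refine Finset.sum_congr rfl fun c _ ↦ ?_
    rw [sq, Finset.sum_mul_sum]
    refine Finset.sum_congr rfl fun k hk ↦ ?_
    have hkc : p k = c := (Finset.mem_filter.1 hk).2
    rw [Finset.sum_filter]
    exact Finset.sum_congr rfl fun l _ ↦ by rw [hkc]; exact if_congr eq_comm rfl rfl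
  rw [hsq, hcl, ← Finset.sum_sub_distrib]
  refine Finset.sum_congr rfl fun k _ ↦ ?_
  rw [← Finset.sum_sub_distrib]
  refine Finset.sum_congr rfl fun l _ ↦ ?_
  by_cases h : p k = p l
  · simp [h]
  · simp [h]

/-- **The Hessian of `∂^α f_M` has at most one positive eigenvalue** (abstract form): for `#E ≤ m`, `1 < m`, the matrix
`H = loopMultipartiteMatrix E p m` has `sigPos ≤ 1`. On the `H`-orthogonal complement of `e_0` (`m z_0 = -s`) one has
`z^T H z = s²/m - Σ_c s_c² ≤ 0` by Lemma 4.12 ("The conclusion now follows from Lemma 4.12").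
[cite: BrandenHuh2019, §4.3 proof of Thm. 4.10, Lemma 4.12] -/
theorem sigPos_loopMultipartite_le_one (E : Finset τ) (p : τ → κ) {m : ℝ} (hE : (E.card : ℝ) ≤ m) (hm : 1 < m) :
    sigPos (Matrix.toBilin' (loopMultipartiteMatrix E p m)).toQuadraticMap ≤ 1 := by
  refine sigPos_le_one_of_orthogonal_nonpos (Matrix.toBilin' (loopMultipartiteMatrix E p m)) (w := Pi.single none 1)
    fun z hz ↦ ?_
  rw [toBilin'_loopMultipartite_single_none] at hz
  rw [toBilin'_loopMultipartite_self, sum_sum_ite_ne_eq]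
  set s := ∑ k ∈ E, z (some k) with hs
  set T := ∑ c ∈ E.image p, (∑ k ∈ E.filter (fun k ↦ p k = c), z (some k)) ^ 2 with hT
  have hCS : s ^ 2 ≤ E.card * T := sq_sum_le_card_mul_sum_fiber_sq_of_subset E p (fun k ↦ z (some k))
  have hT0 : 0 ≤ T := Finset.sum_nonneg fun _ _ ↦ sq_nonneg _
  have hsmT : s ^ 2 ≤ m * T := hCS.trans (mul_le_mul_of_nonneg_right hE hT0)
  have hz0 : m * z none = -s := by
    have h : (m - 1) * (m * z none + s) = 0 := by linarith
    rcases mul_eq_zero.1 h with h1 | h1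
    · linarith
    · linarith
  have hm0 : 0 < m := by linarith
  -- `m · (zᵀHz) = (m-1)(m z_0)² /m … `: multiply through by `m > 0`
  have key : m * (m * (m - 1) * z none ^ 2 + 2 * (m - 1) * z none * s + (s ^ 2 - T)) = s ^ 2 - m * T := by
    have : m * z none = -s := hz0
    nlinarith [this]
  have hle : m * (m * (m - 1) * z none ^ 2 + 2 * (m - 1) * z none * s + (s ^ 2 - T)) ≤ 0 := by
    rw [key]; linarith
  by_contra hpos
  exact absurd (mul_pos hm0 (lt_of_not_ge hpos)) (not_lt.2 hle)

end Signature

end Literature.Combinatorics.LorentzianPolynomials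

end
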